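import Mathlib.FieldTheory.PrimitiveElement
import Mathlib.NumberTheory.NumberField.CMField
import Literature.NumberTheory.NumberFields.TotallyRealOrCM
import Literature.NumberTheory.Automorphic.PatrikisRegularInductionCM
import Literature.NumberTheory.Automorphic.PatrikisCMDescent
import Literature.NumberTheory.Automorphic.AlgebraicityTwist
import HarnessLib

/-!
# Patrikis's remark "regular algebraic induction over a CM field comes from a CM field":
# the printed proof, as a reduction to its inputs (theorems only)

Topic `NumberTheory/Automorphic`; sibling proof file (theorems only: no definition, no named fact)
of `PatrikisRegularInductionCM`, whose named fact
`Patrikis2019_isCMField_of_regular_automorphicInduction` (Patrikis 2019, Rem. 2.4.8 (2) of the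
memoir = arXiv:1207.6724 Rem. 3.2.4, second bullet) is printed with the one-line proof "This
modest consequence of the proposition" — the proposition being Prop. `cmdescent` (memoir
Prop. 2.4.7; tree: the named fact `Patrikis2019_cmDescent`), applied to the inducing datum `π₀`,
whose archimedean parameters are read off those of `π = Ind_L^F(π₀)` (Henniart 2012, Thm. 5 and
Remarque §3.7; tree: the named fact `Henniart2012_infinityType_of_automorphicInduction`).

This file formalises that printed argument completely, so that the fact is reduced to exactly
its published inputs:

* `exists_ne_embedding_apply_eq_of_not_isCMField` — **the field theory of the remark.** Patrikis
  (§2, Notation): "we write `F_cm` for the maximal subfield of `F` on which complex conjugation is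
  well-defined; thus it is the maximal CM or totally real subfield". If `L` is totally complex and
  NOT CM, there are two distinct embeddings `σ₁ ≠ σ₂ : L → ℂ` agreeing on `L_cm` — the `x ∈ L`
  whose complex conjugate is embedding-independent form a subfield `S = L_cm`; `S = L` would make
  complex conjugation well defined on `L`, hence `L` totally real or CM (the tree's
  `NumberFields.isTotallyReal_or_isCMField_of_forall_isConj`), so `[L : S] ≥ 2` and an embedding
  of `S` has two extensions (`AlgHom.card`). Every CM or totally real subfield of `L` lies in `S`
  (`exists_conj_eq_of_mem_subfield`; this is the rendering of "agree on `F_cm`" used by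
  `Patrikis2019_cmDescent`), and so does the image of a CM field `K → L`
  (`exists_conj_eq_algebraMap`), so that `σ₁|_K = σ₂|_K`.
* `InfinityType.not_isRegular_of_sum_of_descent` — **the combinatorics of the remark**: if the
  `z`-exponents of `T_P` at each `σ : K → ℂ` are the sum over `σ' ∣ σ` of those of a well-formed
  `T_π` of positive rank over `L` (Henniart's identity), and the exponents of `T_π` agree at any
  two embeddings agreeing on the CM-or-totally-real subfields (CM descent), then for `K` CM and
  `L` not CM, `T_P` is not regular: `(T_P σ).map a ≥ M + M` with `M = (T_π σ₁).map a ≠ 0`.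
* `Patrikis2019_isCMField_of_regular_automorphicInduction.of_henniart_of_cmDescent` — **the
  named fact from its printed inputs**: `Henniart2012_infinityType_of_automorphicInduction`,
  `Patrikis2019_cmDescent`, and the existence of an infinity type of the inducing cuspidal `π`
  (Clozel 1990 §3.3; the tree's named fact `AutomorphicRepData.exists_hasInfinityType`, passed
  as a hypothesis as in `HenniartAutomorphicInductionStages` / `BaseChangeArchimedean`). The
  algebraicity bookkeeping of the printed proof is done here in full: the exponents `a` AND `b`
  of `T_π` are `a`-exponents of `T_P` (well-formedness `T_π(c ∘ σ') = swap T_π(σ')` and Henniart's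
  identity at `c ∘ σ'|_K`), so `T_P` L-algebraic ⇒ `T_π` L-algebraic, and `T_P` C-algebraic (all
  exponents in `(dn-1)/2 + ℤ`) ⇒ the Borel–Jacquet twist `π ⊗ |det|^{(n-dn)/2}` (a cuspidal
  datum with infinity type `T_π.twist ((n-dn)/2)`, the tree's THEOREM
  `CuspidalAutomorphicRepData.exists_twist_hasInfinityType`; Buzzard–Gee's half-twist when
  `d` is even and `n` odd, e.g. `GL₂`-forms induced from Hecke characters) has a C-algebraic
  infinity type; regularity passes to sub-multisets and to twists.

Nothing here discharges the three inputs: Henniart's archimedean statement is the twisted trace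
formula (Arthur–Clozel) plus Henniart 2010, Prop. `cmdescent` is Clozel's Thm. 3.13 (purity /
`Aut(ℂ)`-conjugates of regular algebraic cusp forms), and `exists_hasInfinityType` is the
admissibility of `π_∞` with Harish-Chandra's isomorphism — none of which the datum model of
`AutomorphicRepsGL` proves yet. `Patrikis2019_isCMField_of_regular_automorphicInduction_holds`
is therefore NOT in this file; it is one line from the last theorem once those land.

## References

* S. Patrikis, *Variations on a theorem of Tate*, Mem. AMS 258 (2019) no. 1238 = arXiv:1207.6724,
  Rem. 2.4.8 (2) (memoir) = Rem. 3.2.4, bullet 2 (arXiv, held text `paper:arxiv-1207.6724`,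
  chunk 24), with Prop. 2.4.7 (`cmdescent`) and §2 (Notation, arXiv; chunk 11: "By a CM field we
  mean … these, and their real subfields, are the number fields on which complex conjugation is
  well-defined … we write `F_cm` for the maximal subfield of `F` on which complex conjugation is
  well-defined"). [Patrikis2019]
* G. Henniart, *Induction automorphe globale pour les corps de nombres*, Bull. SMF 140 (2012),
  Thm. 5 and Remarque §3.7. [Henniart2012]
* K. Buzzard, T. Gee, LMS Lecture Note Ser. 414 (2014), §3.1, §5.3 (the half-twist). [BuzzardGee2014]
* L. Clozel, *Motifs et formes automorphes* (1990), Déf. 1.8, Déf. 3.12, §3.3. [Clozel1990]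
-/

noncomputable section

open scoped NumberField Polynomial Classical ComplexConjugate
open NumberField IsDedekindDomain Polynomial Literature.NumberTheory.Automorphic

namespace Literature.NumberTheory.Automorphic

/-! ### Field theory: number fields on which complex conjugation is well defined -/

section ConjugationWellDefined

/-- **Two embeddings agreeing on `L_cm`.** Let `L` be a totally complex number field that is not
CM. Then there are two distinct complex embeddings `σ₁ ≠ σ₂` of `L` that agree at every `x ∈ L`
whose complex conjugate is embedding-independent (`conj (ι x) = ι y` for one `y` and all
`ι : L → ℂ`), i.e. on Patrikis's `L_cm`, "the maximal subfield of `L` on which complex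
conjugation is well-defined" (§2). Indeed these `x` form a subfield `S`; if `S = L`, complex
conjugation is well defined on `L`, so `L` is totally real or CM
(`NumberFields.isTotallyReal_or_isCMField_of_forall_isConj`), neither of which holds; hence
`[L : S] ≥ 2` and an embedding of `S` has `[L : S]` extensions to `L` (`AlgHom.card`).
[cite: Patrikis2019, Rem. 2.4.8 (2), and §2 (Notation, arXiv:1207.6724)] -/
theorem exists_ne_embedding_apply_eq_of_not_isCMField {L : Type*} [Field L] [NumberField L]
    [IsTotallyComplex L] (hL : ¬ IsCMField L) :
    ∃ σ₁ σ₂ : L →+* ℂ, σ₁ ≠ σ₂ ∧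
      ∀ x : L, (∃ y : L, ∀ ι : L →+* ℂ, conj (ι x) = ι y) → σ₁ x = σ₂ x := by
  -- the subfield of `L` on which complex conjugation is well defined
  let S : IntermediateField ℚ L :=
    { carrier := {x : L | ∃ y : L, ∀ ι : L →+* ℂ, conj (ι x) = ι y}
      mul_mem' := fun {x₁ x₂} h₁ h₂ => by
        obtain ⟨y₁, h₁⟩ := h₁
        obtain ⟨y₂, h₂⟩ := h₂
        exact ⟨y₁ * y₂, fun ι => by rw [map_mul, map_mul, h₁, h₂, map_mul]⟩
      one_mem' := ⟨1, fun ι => by rw [map_one, map_one]⟩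
      add_mem' := fun {x₁ x₂} h₁ h₂ => by
        obtain ⟨y₁, h₁⟩ := h₁
        obtain ⟨y₂, h₂⟩ := h₂
        exact ⟨y₁ + y₂, fun ι => by rw [map_add, map_add, h₁, h₂, map_add]⟩
      zero_mem' := ⟨0, fun ι => by rw [map_zero, map_zero]⟩
      algebraMap_mem' := fun q => ⟨algebraMap ℚ L q, fun ι => by
        rw [eq_ratCast, map_ratCast, map_ratCast]⟩
      inv_mem' := fun x hx => by
        obtain ⟨y, h⟩ := hx
        exact ⟨y⁻¹, fun ι => by rw [map_inv₀, map_inv₀, h, map_inv₀]⟩ }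
  have hmem : ∀ {x : L}, x ∈ S ↔ ∃ y : L, ∀ ι : L →+* ℂ, conj (ι x) = ι y := Iff.rfl
  obtain ⟨ι₀⟩ : Nonempty (L →+* ℂ) := inferInstance
  by_cases hS : S = ⊤
  · -- complex conjugation is well defined on all of `L`: then `L` is CM
    exfalso
    have htop : ∀ x : L, ∃ y : L, ∀ ι : L →+* ℂ, conj (ι x) = ι y := fun x =>
      hmem.mp (hS ▸ IntermediateField.mem_top)
    choose c hc using htop
    have hinj : ∀ {x y : L}, (∀ ι : L →+* ℂ, ι x = ι y) → x = y := fun h => ι₀.injective (h ι₀)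
    have hmul : ∀ x y : L, c (x * y) = c x * c y := fun x y =>
      hinj fun ι => by rw [← hc (x * y) ι, map_mul, map_mul, map_mul, hc x ι, hc y ι]
    have hadd : ∀ x y : L, c (x + y) = c x + c y := fun x y =>
      hinj fun ι => by rw [← hc (x + y) ι, map_add, map_add, map_add, hc x ι, hc y ι]
    have hcc : ∀ x : L, c (c x) = x := fun x =>
      hinj fun ι => by rw [← hc (c x) ι, ← hc x ι, Complex.conj_conj]
    have hrat : ∀ q : ℚ, c (algebraMap ℚ L q) = algebraMap ℚ L q := fun q =>
      hinj fun ι => by rw [← hc _ ι, eq_ratCast, map_ratCast, map_ratCast]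
    let e : L ≃+* L :=
      { toFun := c, invFun := c, left_inv := hcc, right_inv := hcc, map_mul' := hmul,
        map_add' := hadd }
    let σ : L ≃ₐ[ℚ] L := { e with commutes' := hrat }
    have hσ : ∀ φ : L →+* ℂ, ComplexEmbedding.IsConj φ σ := fun φ =>
      RingHom.ext fun x => by
        rw [ComplexEmbedding.conjugate_coe_eq, RingHom.comp_apply]
        exact hc x φ
    rcases NumberFields.isTotallyReal_or_isCMField_of_forall_isConj σ hσ with hTR | hCM
    · haveI := hTR
      exact IsTotallyComplex.complexEmbedding_not_isReal ι₀
        (IsTotallyReal.complexEmbedding_isReal ι₀)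
    · exact hL hCM
  · -- otherwise `[L : S] ≥ 2`, and an embedding of `S` has two distinct extensions to `L`
    have h1 : Module.finrank S L ≠ 1 := fun h =>
      hS (IntermediateField.finrank_eq_one_iff_eq_top.mp h)
    have hlt : 1 < Module.finrank S L := by
      have h0 : 0 < Module.finrank S L := Module.finrank_pos
      omega
    letI : Algebra S ℂ := (ι₀.comp (algebraMap S L)).toAlgebra
    have hcard : 1 < Fintype.card (L →ₐ[S] ℂ) := by rwa [AlgHom.card]
    obtain ⟨f, g, hfg⟩ := Fintype.exists_pair_of_one_lt_card hcard
    refine ⟨(f : L →+* ℂ), (g : L →+* ℂ), fun h => hfg (AlgHom.coe_ringHom_injective h),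
      fun x hx => ?_⟩
    have hx' : x ∈ S := hmem.mpr hx
    have hfx : f x = algebraMap S ℂ ⟨x, hx'⟩ := f.commutes ⟨x, hx'⟩
    have hgx : g x = algebraMap S ℂ ⟨x, hx'⟩ := g.commutes ⟨x, hx'⟩
    change f x = g x
    rw [hfx, hgx]

variable {L : Type*} [Field L] [NumberField L]

/-- On a CM or totally real subfield `M ≤ L` complex conjugation is well defined: for `x ∈ M`
there is `y ∈ L` (namely `c_M x`, resp. `x`) with `conj (ι x) = ι y` for every embedding
`ι : L → ℂ` (Mathlib: `IsCMField.complexEmbedding_complexConj`,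
`IsTotallyReal.le_maximalRealSubfield`) — i.e. `M ⊆ L_cm` ("thus it is the maximal CM or totally
real subfield", Patrikis §2); this matches the rendering "agree on every subfield that is CM or
totally real" of `Patrikis2019_cmDescent`. [cite: Patrikis2019, §2 (Notation, arXiv:1207.6724)] -/
theorem exists_conj_eq_of_mem_subfield (M : Subfield L) (hM : IsCMField M ∨ IsTotallyReal M)
    {x : L} (hx : x ∈ M) : ∃ y : L, ∀ ι : L →+* ℂ, conj (ι x) = ι y := by
  rcases hM with hM | hM
  · haveI := hM
    haveI : Algebra.IsIntegral ℚ M :=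
      Algebra.IsIntegral.of_injective M.subtype.toRatAlgHom Subtype.val_injective
    refine ⟨(IsCMField.complexConj M ⟨x, hx⟩ : M), fun ι => ?_⟩
    have h := IsCMField.complexEmbedding_complexConj M (ι.comp M.subtype) ⟨x, hx⟩
    rw [RingHom.comp_apply, RingHom.comp_apply] at h
    exact h.symm
  · haveI := hM
    exact ⟨x, fun ι => IsTotallyReal.le_maximalRealSubfield M hx ι⟩

omit [NumberField L] in
/-- On the image of a CM field `K → L` complex conjugation is well defined: `conj (ι k) = ι (c_K k)`
for every embedding `ι` of `L` (`ι|_K` is an embedding of the CM field `K`). So two embeddings of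
`L` as in `exists_ne_embedding_apply_eq_of_not_isCMField` restrict to the same embedding of `K`.
[cite: Patrikis2019, §2 (Notation, arXiv:1207.6724)] -/
theorem exists_conj_eq_algebraMap (K : Type*) [Field K] [NumberField K] [IsCMField K]
    [Algebra K L] (k : K) : ∃ y : L, ∀ ι : L →+* ℂ, conj (ι (algebraMap K L k)) = ι y :=
  ⟨algebraMap K L (IsCMField.complexConj K k), fun ι => by
    have h := IsCMField.complexEmbedding_complexConj K (ι.comp (algebraMap K L)) k
    rw [RingHom.comp_apply, RingHom.comp_apply] at h
    exact h.symm⟩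

end ConjugationWellDefined

/-! ### The combinatorics of the remark on infinity types -/

section Combinatorics

variable {K : Type} [Field K] [NumberField K] {L : Type} [Field L] [NumberField L] [Algebra K L]

/-- **Regular induction from a non-CM field is impossible, on infinity types** (the content of
Patrikis 2019, Rem. 2.4.8 (2), granted its two inputs as hypotheses on the types). Let `K` be CM,
`L ⊇ K` not CM, `T_P` an infinity type over `K` and `T_π` a well-formed infinity type of positive
rank `n` over `L` such that (Henniart's identity) `(T_P σ).map a = ∑_{σ' ∣ σ} (T_π σ').map a` for
every `σ : K → ℂ`, and (CM descent) `(T_π ι).map a = (T_π ι').map a` whenever `ι, ι'` agree on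
every CM or totally real subfield of `L`. Then `T_P` is not regular: `L` is totally complex
(it contains the totally complex `K`) and not CM, so two distinct `σ₁ ≠ σ₂ : L → ℂ` agree on
`L_cm ⊇ K`; they lie over the same `σ`, have the same exponent multiset `M ≠ 0`, and
`M + M ≤ (T_P σ).map a` has a repetition (Clozel, Déf. 3.12).
[cite: Patrikis2019, Rem. 2.4.8 (2)] -/
theorem InfinityType.not_isRegular_of_sum_of_descent (hK : IsCMField K) (hL : ¬ IsCMField L)
    {N n : ℕ} (hn : 0 < n) {TP : InfinityType K N} {Tπ : InfinityType L n}
    (hwf : Tπ.IsWellFormed)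
    (hsum : ∀ σ : K →+* ℂ, (TP σ).map ArchWeight.a =
      ∑ σ' ∈ Finset.univ.filter (fun σ' : L →+* ℂ => σ'.comp (algebraMap K L) = σ),
        (Tπ σ').map ArchWeight.a)
    (hdesc : ∀ ι ι' : L →+* ℂ,
      (∀ M : Subfield L, (IsCMField M ∨ IsTotallyReal M) → ∀ x ∈ M, ι x = ι' x) →
      (Tπ ι).map ArchWeight.a = (Tπ ι').map ArchWeight.a) :
    ¬ TP.IsRegular := by
  intro hreg
  haveI := hK
  haveI : IsTotallyComplex L := isTotallyComplex_of_algebra K L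
  obtain ⟨σ₁, σ₂, hne, hagree⟩ := exists_ne_embedding_apply_eq_of_not_isCMField hL
  have hK12 : σ₁.comp (algebraMap K L) = σ₂.comp (algebraMap K L) :=
    RingHom.ext fun k => hagree _ (exists_conj_eq_algebraMap K k)
  have hM12 : ∀ M : Subfield L, (IsCMField M ∨ IsTotallyReal M) → ∀ x ∈ M, σ₁ x = σ₂ x :=
    fun M hM x hx => hagree x (exists_conj_eq_of_mem_subfield M hM hx)
  have heq := hdesc σ₁ σ₂ hM12
  set σ := σ₁.comp (algebraMap K L) with hσ
  have hpair : ∑ τ ∈ ({σ₁, σ₂} : Finset (L →+* ℂ)), (Tπ τ).map ArchWeight.a =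
      (Tπ σ₁).map ArchWeight.a + (Tπ σ₂).map ArchWeight.a := Finset.sum_pair hne
  have hle : (Tπ σ₁).map ArchWeight.a + (Tπ σ₂).map ArchWeight.a ≤ (TP σ).map ArchWeight.a := by
    rw [hsum σ, ← hpair]
    apply Finset.sum_le_sum_of_subset
    intro τ hτ
    rw [Finset.mem_insert, Finset.mem_singleton] at hτ
    rw [Finset.mem_filter]
    rcases hτ with rfl | rfl
    · exact ⟨Finset.mem_univ _, rfl⟩
    · exact ⟨Finset.mem_univ _, hK12.symm⟩
  rw [← heq] at hle
  have hnd : ((Tπ σ₁).map ArchWeight.a + (Tπ σ₁).map ArchWeight.a).Nodup :=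
    Multiset.nodup_of_le hle (hreg σ)
  have hne0 : (Tπ σ₁).map ArchWeight.a ≠ 0 := by
    intro h0
    have hcard := congrArg Multiset.card h0
    rw [Multiset.card_map, hwf.1 σ₁, Multiset.card_zero] at hcard
    omega
  obtain ⟨x, hx⟩ := Multiset.exists_mem_of_ne_zero hne0
  exact Multiset.disjoint_left.mp (Multiset.nodup_add.mp hnd).2.2 hx hx

end Combinatorics

/-! ### The named fact from its printed inputs -/

/-- **Patrikis 2019, Rem. 2.4.8 (2), by its printed proof** ("modest consequence of the
proposition"): the named fact `Patrikis2019_isCMField_of_regular_automorphicInduction` follows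
from (1) Henniart's archimedean description of automorphic induction along a cyclic extension
(`Henniart2012_infinityType_of_automorphicInduction`: `(T_P σ).map a = ∑_{σ' ∣ σ} (T_π σ').map a`),
(2) Prop. `cmdescent` (`Patrikis2019_cmDescent`: the infinity type of a regular C- or L-algebraic
cuspidal representation of `GL_n` over a totally imaginary field descends to its maximal CM
subfield), and (3) the existence of an infinity type of the inducing cuspidal `π` (Clozel 1990,
§3.3; the tree's named fact `AutomorphicRepData.exists_hasInfinityType`). Proof: the exponents
`a` and (by well-formedness at `c ∘ σ'`) `b` of `T_π` are `a`-exponents of `T_P`, so `T_π` is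
regular and either L-algebraic (if `T_P` is) or C-algebraic after the twist
`π ⊗ |det|^{(n - dn)/2}` (if `T_P` is C-algebraic; `CuspidalAutomorphicRepData.exists_twist_hasInfinityType`,
Buzzard–Gee §5.3); Prop. `cmdescent` for `π` (resp. its twist, whose exponent multisets are
translates) gives the descent hypothesis of `InfinityType.not_isRegular_of_sum_of_descent`,
which contradicts the regularity of `T_P` unless `L` is CM.
[cite: Patrikis2019, Rem. 2.4.8 (2) (= arXiv:1207.6724 Rem. 3.2.4, bullet 2)]
[cite: Henniart2012, Thm. 5 and Remarque §3.7] [cite: BuzzardGee2014, §5.3] -/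
theorem Patrikis2019_isCMField_of_regular_automorphicInduction.of_henniart_of_cmDescent
    (hH : Henniart2012_infinityType_of_automorphicInduction) (hD : Patrikis2019_cmDescent)
    (hex : ∀ (n : ℕ) (L : Type) [Field L] [NumberField L]
      (hL : isCompact_glFiniteIntegralLevel n L) (π : CuspidalAutomorphicRepData n L hL),
      π.1.exists_hasInfinityType) :
    Patrikis2019_isCMField_of_regular_automorphicInduction := by
  intro K L _ _ _ _ _ _ hcyc hKcm n d hn hd hK hL P π hTP hAI
  obtain ⟨TP, hTP, hreg, halg⟩ := hTP
  by_contra hLcm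
  obtain ⟨Tπ, hTπ⟩ := hex n L hL π
  have hHen := hH K L hcyc n d hn hd hK hL P π hAI TP Tπ hTP hTπ
  -- the exponent multiset of `T_π` at `τ` is a sub-multiset of that of `T_P` at `τ|_K`
  have hsub : ∀ τ : L →+* ℂ,
      (Tπ τ).map ArchWeight.a ≤ (TP (τ.comp (algebraMap K L))).map ArchWeight.a := by
    intro τ
    rw [hHen (τ.comp (algebraMap K L))]
    exact Finset.single_le_sum_of_canonicallyOrdered (M := Multiset ℂ)
      (f := fun σ' : L →+* ℂ => (Tπ σ').map ArchWeight.a)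
      (Finset.mem_filter.mpr ⟨Finset.mem_univ τ, rfl⟩)
  have hregπ : Tπ.IsRegular := fun τ => Multiset.nodup_of_le (hsub τ) (hreg _)
  -- every exponent `a` and `b` of `T_π` is an `a`-exponent of `T_P`
  have ha : ∀ (τ : L →+* ℂ), ∀ p ∈ Tπ τ, ∃ (σ : K →+* ℂ), ∃ q ∈ TP σ, q.a = p.a := by
    intro τ p hp
    have hmem : p.a ∈ (TP (τ.comp (algebraMap K L))).map ArchWeight.a :=
      Multiset.mem_of_le (hsub τ) (Multiset.mem_map_of_mem _ hp)
    obtain ⟨q, hq, hqa⟩ := Multiset.mem_map.mp hmem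
    exact ⟨_, q, hq, hqa⟩
  have hb : ∀ (τ : L →+* ℂ), ∀ p ∈ Tπ τ, ∃ (σ : K →+* ℂ), ∃ q ∈ TP σ, q.a = p.b := by
    intro τ p hp
    have hswap : p.swap ∈ Tπ (ComplexEmbedding.conjugate τ) := by
      rw [hTπ.1.2 τ]
      exact Multiset.mem_map_of_mem _ hp
    obtain ⟨σ, q, hq, hqa⟩ := ha _ _ hswap
    exact ⟨σ, q, hq, by rw [hqa, ArchWeight.swap_a]⟩
  haveI := hKcm
  have hLtc : IsTotallyComplex L := isTotallyComplex_of_algebra K L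
  haveI : NeZero n := NeZero.of_pos hn
  -- CM descent for the exponent multisets of `T_π` (Prop. `cmdescent` for `π` or its twist)
  have hdesc : ∀ ι ι' : L →+* ℂ,
      (∀ M : Subfield L, (IsCMField M ∨ IsTotallyReal M) → ∀ x ∈ M, ι x = ι' x) →
      (Tπ ι).map ArchWeight.a = (Tπ ι').map ArchWeight.a := by
    intro ι ι' hιι'
    rcases halg with hC | hLalg
    · -- `T_P` C-algebraic: twist `π` by `|det|^{(n - dn)/2}`
      set s : ℝ := ((n : ℝ) - (d : ℝ) * (n : ℝ)) / 2 with hs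
      obtain ⟨χ, π', -, -, -, hT'⟩ := π.exists_twist_hasInfinityType s hTπ
      have hC' : (Tπ.twist (s : ℂ)).IsCAlgebraic := by
        intro τ p' hp'
        rw [InfinityType.twist_apply] at hp'
        obtain ⟨p, hp, rfl⟩ := Multiset.mem_map.mp hp'
        obtain ⟨σ₁, q₁, hq₁, hq₁a⟩ := ha τ p hp
        obtain ⟨σ₂, q₂, hq₂, hq₂b⟩ := hb τ p hp
        obtain ⟨k, -, hk, -⟩ := hC σ₁ q₁ hq₁
        obtain ⟨l, -, hl, -⟩ := hC σ₂ q₂ hq₂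
        refine ⟨k, l, ?_, ?_⟩
        · rw [ArchWeight.twist_a, ← hq₁a, hk, hs]
          push_cast
          ring
        · rw [ArchWeight.twist_b, ← hq₂b, hl, hs]
          push_cast
          ring
      have h := hD L hLtc n hL π' (Tπ.twist (s : ℂ)) hT' (hregπ.twist _) (Or.inl hC') ι ι' hιι'
      rw [InfinityType.map_a_twist, InfinityType.map_a_twist] at h
      exact Multiset.map_injective (add_left_injective _) h
    · -- `T_P` L-algebraic: so is `T_π`
      have hL' : Tπ.IsLAlgebraic := by
        intro τ p hp
        obtain ⟨σ₁, q₁, hq₁, hq₁a⟩ := ha τ p hp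
        obtain ⟨σ₂, q₂, hq₂, hq₂b⟩ := hb τ p hp
        obtain ⟨k, -, hk, -⟩ := hLalg σ₁ q₁ hq₁
        obtain ⟨l, -, hl, -⟩ := hLalg σ₂ q₂ hq₂
        exact ⟨k, l, by rw [← hq₁a, hk], by rw [← hq₂b, hl]⟩
      exact hD L hLtc n hL π Tπ hTπ hregπ (Or.inr hL') ι ι' hιι'
  exact InfinityType.not_isRegular_of_sum_of_descent hKcm hLcm hn hTπ.1 hHen hdesc hreg

end Literature.NumberTheory.Automorphic
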